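import Summits.HodgeConjecture.CorCM.MultiFieldWeilDihedralFive
import HarnessLib

/-!
# MULTI-FIELD WEIL ENGINE — THE DIHEDRAL PENTAGON, II: the `ℚ(√5)`-criterion made checkable (symmetries transfer along a `ℚ[A]`-relation; two `2`-sets with different
# axes are independent) and the conjugated form of the separation theorem (census level)

Cell `pub-hodgecm2` (COR-CM), seat b30 gen 42 (2026-08-26); count-neutral own lane MULTI-FIELD WEIL ENGINE (stem `MultiFieldWeil*`), census level, the sequel of
`CorCM/MultiFieldWeilDihedralFive.lean` (`const_of_signed_dihedral_five`: over `H ⊇ D₅ = {x ↦ x + t, x ↦ t − x} ⊆ Sym(ℤ/5)` the signed equations of several position sets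
`Q_i` force constant defects as soon as the centred indicators `c_i = 5·𝟙_{Q_i} − |Q_i|` admit no relation `Σ_i (x_i + y_i A) c_i = 0`, `A c(s) = c(s+1) + c(s−1) − c(s+2) −
c(s−2)`, i.e. are independent over `ℚ[A] ≅ ℚ(√5)`).  Theorems only; no definition, no named fact, no `sorry`, no `decide` beyond numerals of `Fin 5`.  HONEST FRAMING: pure
finite combinatorics and linear algebra; `HC_CM` is NOT touched.

* §3 THE CRITERION MADE CHECKABLE.  `eq_zero_of_sq_eq_five_mul_sq` (`√5 ∉ ℚ`); **`eq_zero_of_fRelation_single`**: `x + yA` is invertible on mass-zero functions for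
  `(x, y) ≠ (0, 0)` (`(x − yA)(x + yA) f = (x² − 5y²) f`, as `A² = 5` on mass-zero functions) — so ONE proper non-empty set is always independent; `shiftSum_apply_perm` (`A`
  commutes with rotations `σ(s+t) = σ(s)+t` and reflections `σ(s+t) = σ(s)−t`); **`comp_eq_of_fRelation`**: in a relation `(x₁ + y₁A)c₁ + (x₂ + y₂A)c₂ = 0` with `(x₂, y₂) ≠ 0`
  every rotation ∕ reflection fixing `c₁` fixes `c₂` (READING: two position sets related over `ℚ(√5)` have the same stabiliser in `D₅`); hence
  **`fIndependent_of_card_le_two`**: at most two mass-zero non-zero functions such that for `i ≠ j` some rotation ∕ reflection fixes `c_j` and not `c_i` are `ℚ[A]`-independent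
  (the hypothesis `hF` of `const_of_signed_dihedral_five`); for `2`-subsets: every `{a, b}` is stabilised by the reflection `x ↦ a + b − x` (`exists_subLeft_stabilising_pair`),
  so (**`fIndependent_pairs_of_sum_ne`**) at most two `2`-subsets of `ℤ/5` none of which is stabilised by the axis of another — `{a, b} ≠ {a', b'}` with `a + b ≠ a' + b'`; in
  particular any two DISTINCT `2`-sets SHARING a letter — are `ℚ[A]`-independent.  (The `5` unordered pairs `{edge, disjoint diagonal}` of the pentagon have a common axis and
  ARE dependent: `CorCM/MultiFieldWeilCommutantNoGo.lean`.)
* §4 `const_of_signed_of_conj` (separation is invariant under conjugation, any size) and **`const_of_signed_dihedral_five_conj`**: the separation theorem with the ten dihedral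
  maps conjugated by an arbitrary `g ∈ Sym(5)` — the form in which the realised tuples present a dihedral image once an element of order `5` has been conjugated to the
  standard rotation (`exists_conj_finRotate_of_orderOf_eq`) — the independence being asked of the transported sets `g⁻¹ Q_i`.
[cite: Serre1977, §2.3 Ex. 2.6; §5.3] [cite: Washington1997, Lemma 2.4 and §2] [cite: DixonMortimer1996, §1.4 Ex. 1.4.1–1.4.2; §2.1] [cite: Lang2002, XIII §4]

## References
* [Serre1977] J.-P. Serre, *Linear Representations of Finite Groups*, GTM 42, §2.3 Ex. 2.6, §5.3 (the dihedral groups).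
* [Washington1997] L. C. Washington, *Introduction to Cyclotomic Fields*, 2nd ed., GTM 83, §2, Lemma 2.4.
* [DixonMortimer1996] J. D. Dixon, B. Mortimer, *Permutation Groups*, GTM 163, §1.4 Ex. 1.4.1–1.4.2, §2.1.
* [Lang2002] S. Lang, *Algebra*, GTM 211, XIII §4.
-/

noncomputable section

namespace Summit.HodgeConjecture.CorCM.MultiFieldWeil

open Finset
open Fin.CommRing

open scoped Classical

/-! ## §3 The criterion made checkable -/

section Criterion

/-- `x² = 5y²` has no rational solution but `(0, 0)` (`√5 ∉ ℚ`). [cite: Washington1997, Lemma 2.4] -/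
theorem eq_zero_of_sq_eq_five_mul_sq {x y : ℚ} (h : x ^ 2 = 5 * y ^ 2) : x = 0 ∧ y = 0 := by
  by_cases hy : y = 0
  · subst hy
    have hx : x ^ 2 = 0 := by simpa using h
    exact ⟨pow_eq_zero_iff (two_ne_zero) |>.1 hx, rfl⟩
  · exfalso
    have h5 : IsSquare ((5 : ℕ) : ℚ) := ⟨x / y, by rw [Nat.cast_ofNat]; field_simp; linear_combination -h⟩
    exact (Nat.prime_five.not_isSquare) (Rat.isSquare_natCast_iff.1 h5)

/-- **`x + yA` is invertible on mass-zero functions** (`(x, y) ≠ (0, 0)` rational): if `f : ℤ/5 → ℚ` has mass zero and `x f + y A f = 0`, then `f = 0` — apply `x − yA` and use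
`A² f = 5 f` for mass-zero `f`, then `x² ≠ 5y²`. [cite: Washington1997, Lemma 2.4] [cite: Serre1977, §5.3] -/
theorem eq_zero_of_fRelation_single (f : Fin 5 → ℚ) (hf : ∑ s, f s = 0) {x y : ℚ} (hxy : ¬ (x = 0 ∧ y = 0))
    (hrel : ∀ s, x * f s + y * (f (s + 1) + f (s - 1) - f (s + 2) - f (s - 2)) = 0) (s : Fin 5) : f s = 0 := by
  have hm : f s + f (s + 1) + f (s + 2) + f (s - 2) + f (s - 1) = 0 := by
    have h := hf
    rw [← Equiv.sum_comp (Equiv.addLeft s) f, Fin.sum_univ_five] at h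
    have e0 : s + 0 = s := add_zero s
    have e3 : s + 3 = s - 2 := by linear_combination five_eq_zero_fin
    have e4 : s + 4 = s - 1 := by linear_combination five_eq_zero_fin
    simp only [Equiv.coe_addLeft, e0, e3, e4] at h
    linarith
  have r0 := hrel s
  have r1 := hrel (s + 1)
  have r4 := hrel (s - 1)
  have r2 := hrel (s + 2)
  have r3 := hrel (s - 2)
  have e11 : s + 1 + 1 = s + 2 := by ring
  have e12 : s + 1 - 1 = s := by ring
  have e13 : s + 1 + 2 = s - 2 := by linear_combination five_eq_zero_fin
  have e14 : s + 1 - 2 = s - 1 := by ring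
  have e41 : s - 1 + 1 = s := by ring
  have e42 : s - 1 - 1 = s - 2 := by ring
  have e43 : s - 1 + 2 = s + 1 := by ring
  have e44 : s - 1 - 2 = s + 2 := by linear_combination (-1 : Fin 5) * five_eq_zero_fin
  have e21 : s + 2 + 1 = s - 2 := by linear_combination five_eq_zero_fin
  have e22 : s + 2 - 1 = s + 1 := by ring
  have e23 : s + 2 + 2 = s - 1 := by linear_combination five_eq_zero_fin
  have e24 : s + 2 - 2 = s := by ring
  have e31 : s - 2 + 1 = s - 1 := by ring
  have e32 : s - 2 - 1 = s + 2 := by linear_combination (-1 : Fin 5) * five_eq_zero_fin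
  have e33 : s - 2 + 2 = s := by ring
  have e34 : s - 2 - 2 = s + 1 := by linear_combination (-1 : Fin 5) * five_eq_zero_fin
  rw [e11, e12, e13, e14] at r1
  rw [e41, e42, e43, e44] at r4
  rw [e21, e22, e23, e24] at r2
  rw [e31, e32, e33, e34] at r3
  have key : (x ^ 2 - 5 * y ^ 2) * f s = 0 := by
    linear_combination x * r0 - y * (r1 + r4 - r2 - r3) - y ^ 2 * hm
  rcases mul_eq_zero.1 key with hk | hk
  · exact absurd (eq_zero_of_sq_eq_five_mul_sq (sub_eq_zero.1 hk)) hxy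
  · exact hk

/-- **The operator `A` commutes with the dihedral maps**: for `σ` a rotation (`σ(s + t) = σ(s) + t`) or a reflection (`σ(s + t) = σ(s) − t`) and any `F`,
`(A F)(σ s)` is `A` of `F ∘ σ` at `s` (for a reflection the four terms are permuted). [cite: Serre1977, §5.3] -/
theorem shiftSum_apply_perm (σ : Equiv.Perm (Fin 5)) (hσ : (∀ s t : Fin 5, σ (s + t) = σ s + t) ∨ (∀ s t : Fin 5, σ (s + t) = σ s - t))
    (F : Fin 5 → ℚ) (s : Fin 5) :
    F (σ s + 1) + F (σ s - 1) - F (σ s + 2) - F (σ s - 2) = F (σ (s + 1)) + F (σ (s - 1)) - F (σ (s + 2)) - F (σ (s - 2)) := by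
  rcases hσ with hσ | hσ
  · have e2 : σ (s - 1) = σ s - 1 := by rw [sub_eq_add_neg, hσ, ← sub_eq_add_neg]
    have e4 : σ (s - 2) = σ s - 2 := by rw [sub_eq_add_neg, hσ, ← sub_eq_add_neg]
    rw [hσ s 1, hσ s 2, e2, e4]
  · have e2 : σ (s - 1) = σ s + 1 := by rw [sub_eq_add_neg, hσ, sub_neg_eq_add]
    have e4 : σ (s - 2) = σ s + 2 := by rw [sub_eq_add_neg, hσ, sub_neg_eq_add]
    rw [hσ s 1, hσ s 2, e2, e4]
    ring

/-- **SYMMETRIES TRANSFER ALONG A `ℚ[A]`-RELATION.**  In a relation `(x₁ + y₁A) c₁ + (x₂ + y₂A) c₂ = 0` with `(x₂, y₂) ≠ (0, 0)`, every rotation or reflection `σ` of `ℤ/5`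
with `c₁ ∘ σ = c₁` has `c₂ ∘ σ = c₂`: `ℚ[A]` commutes with `σ`, so `g = c₂ ∘ σ − c₂` (mass zero) satisfies `(x₂ + y₂A) g = 0`, and `x₂ + y₂A` is invertible.  READING: two
position sets related over `ℚ(√5)` have the same stabiliser in `D₅`. [cite: Serre1977, §5.3] [cite: Washington1997, Lemma 2.4] -/
theorem comp_eq_of_fRelation (c₁ c₂ : Fin 5 → ℚ) {x₁ y₁ x₂ y₂ : ℚ} (h₂ : ¬ (x₂ = 0 ∧ y₂ = 0))
    (hrel : ∀ s, x₁ * c₁ s + y₁ * (c₁ (s + 1) + c₁ (s - 1) - c₁ (s + 2) - c₁ (s - 2)) +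
      (x₂ * c₂ s + y₂ * (c₂ (s + 1) + c₂ (s - 1) - c₂ (s + 2) - c₂ (s - 2))) = 0)
    (σ : Equiv.Perm (Fin 5)) (hσ : (∀ s t : Fin 5, σ (s + t) = σ s + t) ∨ (∀ s t : Fin 5, σ (s + t) = σ s - t))
    (h₁ : ∀ s, c₁ (σ s) = c₁ s) (s : Fin 5) : c₂ (σ s) = c₂ s := by
  set g : Fin 5 → ℚ := fun s => c₂ (σ s) - c₂ s with hg
  have hgm : ∑ s, g s = 0 := by
    simp only [hg, Finset.sum_sub_distrib, Equiv.sum_comp σ c₂, sub_self]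
  have hrelg : ∀ s, x₂ * g s + y₂ * (g (s + 1) + g (s - 1) - g (s + 2) - g (s - 2)) = 0 := by
    intro s
    have r := hrel s
    have r' := hrel (σ s)
    rw [shiftSum_apply_perm σ hσ c₁ s, shiftSum_apply_perm σ hσ c₂ s] at r'
    simp only [h₁] at r'
    simp only [hg]
    linear_combination r' - r
  exact sub_eq_zero.1 (eq_zero_of_fRelation_single g hgm h₂ hrelg s)

/-- **`ℚ[A]`-INDEPENDENCE OF AT MOST TWO SETS FROM SYMMETRY BREAKING.**  `c_i : ℤ/5 → ℚ` (`|ι| ≤ 2`) mass-zero and non-zero; if for `i ≠ j` some rotation or reflection of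
`ℤ/5` fixes `c_j` but not `c_i`, then no non-trivial relation `Σ_i (x_i c_i + y_i A c_i) = 0` holds (the hypothesis `hF` of `const_of_signed_dihedral_five`).  With one index a
relation kills `c_i` (`eq_zero_of_fRelation_single`); with two, the symmetry of the other set would transfer to the set carrying the non-zero coefficient
(`comp_eq_of_fRelation`). [cite: Serre1977, §5.3] [cite: Lang2002, XIII §4] -/
theorem fIndependent_of_card_le_two {ι : Type} [Fintype ι] (hι : Fintype.card ι ≤ 2) (c : ι → Fin 5 → ℚ) (hc0 : ∀ i, ∑ s, c i s = 0)
    (hne : ∀ i, ∃ s, c i s ≠ 0)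
    (hbreak : ∀ i j, i ≠ j → ∃ σ : Equiv.Perm (Fin 5), ((∀ s t : Fin 5, σ (s + t) = σ s + t) ∨ (∀ s t : Fin 5, σ (s + t) = σ s - t)) ∧
      (∀ s, c j (σ s) = c j s) ∧ ∃ s, c i (σ s) ≠ c i s)
    (x y : ι → ℚ) (hrel : ∀ s : Fin 5, ∑ i, (x i * c i s + y i * (c i (s + 1) + c i (s - 1) - c i (s + 2) - c i (s - 2))) = 0) (i : ι) :
    x i = 0 ∧ y i = 0 := by
  by_contra hi
  by_cases hex : ∃ j, j ≠ i
  · obtain ⟨j, hj⟩ := hex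
    have hcard : (({j, i} : Finset ι)).card = Fintype.card ι := by
      refine le_antisymm (Finset.card_le_univ _) ?_
      rw [Finset.card_pair hj]; exact hι
    have huniv : ({j, i} : Finset ι) = Finset.univ := Finset.eq_univ_of_card _ hcard
    have hsum : ∀ s, x j * c j s + y j * (c j (s + 1) + c j (s - 1) - c j (s + 2) - c j (s - 2)) +
        (x i * c i s + y i * (c i (s + 1) + c i (s - 1) - c i (s + 2) - c i (s - 2))) = 0 := fun s => by
      have := hrel s
      rwa [← huniv, Finset.sum_pair hj] at this
    obtain ⟨σ, hσ, hfix, s₀, hs₀⟩ := hbreak i j hj.symm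
    exact hs₀ (comp_eq_of_fRelation (c j) (c i) hi hsum σ hσ hfix s₀)
  · have hall : ∀ j, j = i := fun j => by by_contra h; exact hex ⟨j, h⟩
    have huniv : ({i} : Finset ι) = Finset.univ := Finset.eq_univ_iff_forall.2 fun j => by rw [hall j]; exact Finset.mem_singleton_self _
    have hsum : ∀ s, x i * c i s + y i * (c i (s + 1) + c i (s - 1) - c i (s + 2) - c i (s - 2)) = 0 := fun s => by
      have := hrel s
      rwa [← huniv, Finset.sum_singleton] at this
    obtain ⟨s, hs⟩ := hne i
    exact hs (eq_zero_of_fRelation_single (c i) (hc0 i) hi hsum s)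

/-- A centred indicator `5·𝟙_Q − |Q|` of a PROPER NON-EMPTY `Q ⊆ ℤ/5` has mass zero and is not zero. [folklore] -/
theorem centred_five_sum_eq_zero_and_ne (Q : Finset (Fin 5)) (c : Fin 5 → ℚ) (hc : ∀ s, c s = 5 * (if s ∈ Q then 1 else 0) - Q.card)
    (h0 : Q.Nonempty) (h5 : Q ≠ Finset.univ) : (∑ s, c s = 0) ∧ ∃ s, c s ≠ 0 := by
  refine ⟨?_, ?_⟩
  · simp only [hc, Finset.sum_sub_distrib, ← Finset.mul_sum, Finset.sum_boole, Finset.sum_const, Finset.card_univ, Fintype.card_fin, nsmul_eq_mul]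
    simp
  · obtain ⟨a, ha⟩ := h0
    obtain ⟨b, -, hb⟩ : ∃ b ∈ (Finset.univ : Finset (Fin 5)), b ∉ Q := by
      by_contra h
      push Not at h
      exact h5 (Finset.eq_univ_iff_forall.2 fun b => h b (Finset.mem_univ b))
    by_contra h
    push Not at h
    have h1 := h a
    have h2 := h b
    rw [hc, if_pos ha] at h1
    rw [hc, if_neg hb] at h2
    linarith

/-- `c ∘ σ = c` for a centred indicator `c = 5·𝟙_Q − |Q|` says exactly that `σ` stabilises `Q`. [folklore] -/
theorem centred_five_comp_eq_iff (Q : Finset (Fin 5)) (c : Fin 5 → ℚ) (hc : ∀ s, c s = 5 * (if s ∈ Q then 1 else 0) - Q.card)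
    (σ : Equiv.Perm (Fin 5)) (s : Fin 5) : c (σ s) = c s ↔ (σ s ∈ Q ↔ s ∈ Q) := by
  rw [hc, hc]
  constructor
  · intro h
    by_cases h1 : σ s ∈ Q <;> by_cases h2 : s ∈ Q <;> simp only [h1, h2, if_true, if_false] at h ⊢ <;> linarith
  · intro h
    simp only [h]

/-- **The reflection `x ↦ t − x` is a reflection**: `σ(s + j) = σ(s) − j`; the rotation `x ↦ x + t` is a rotation. [folklore] -/
theorem subLeft_add_eq (t s j : Fin 5) : Equiv.subLeft t (s + j) = Equiv.subLeft t s - j := by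
  show t - (s + j) = t - s - j
  ring

/-- The rotation `x ↦ x + t` satisfies `σ(s + j) = σ(s) + j`. [folklore] -/
theorem addRight_add_eq (t s j : Fin 5) : Equiv.addRight t (s + j) = Equiv.addRight t s + j := by
  show s + j + t = s + t + j
  ring

/-- **Every `2`-subset `{a, b}` of `ℤ/5` is stabilised by the reflection `x ↦ (a + b) − x`, which moves some letter.** [folklore] -/
theorem exists_subLeft_stabilising_pair {Q : Finset (Fin 5)} (hQ : Q.card = 2) :
    ∃ t : Fin 5, (∀ s, Equiv.subLeft t s ∈ Q ↔ s ∈ Q) ∧ ∃ s, Equiv.subLeft t s ≠ s := by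
  obtain ⟨a, b, hab, rfl⟩ := Finset.card_eq_two.1 hQ
  refine ⟨a + b, fun s => ?_, ?_⟩
  · show a + b - s ∈ ({a, b} : Finset (Fin 5)) ↔ s ∈ ({a, b} : Finset (Fin 5))
    simp only [Finset.mem_insert, Finset.mem_singleton]
    constructor
    · rintro (h | h)
      · right; linear_combination (-1 : Fin 5) * h
      · left; linear_combination (-1 : Fin 5) * h
    · rintro (rfl | rfl)
      · right; ring
      · left; ring
  · by_cases h : a + b - 0 = (0 : Fin 5)
    · refine ⟨1, fun h1 => ?_⟩
      have h1' : a + b - 1 = (1 : Fin 5) := h1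
      have : (2 : Fin 5) = 0 := by linear_combination h - h1'
      exact absurd this (by decide)
    · exact ⟨0, h⟩

/-- **TWO `2`-SUBSETS OF `ℤ/5` WITH DIFFERENT SUMS ARE `ℚ[A]`-INDEPENDENT**: for `{a, b} ≠ {a', b'}` read as position sets, `a + b ≠ a' + b'` (different axes of symmetry) gives
the hypothesis `hF` of `const_of_signed_dihedral_five` (the reflection `x ↦ a + b − x` stabilises `{a, b}` and not `{a', b'}`); in particular two DISTINCT `2`-sets SHARING a letter
qualify.  The `5` excluded unordered pairs `{edge, disjoint diagonal}` of the pentagon are genuinely dependent (`CorCM/MultiFieldWeilCommutantNoGo.lean`). [cite: Serre1977, §5.3]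
[cite: Lang2002, XIII §4] -/
theorem fIndependent_pairs_of_sum_ne {ι : Type} [Fintype ι] (hι : Fintype.card ι ≤ 2) (Q : ι → Finset (Fin 5)) (hQ : ∀ i, (Q i).card = 2)
    (hsum : ∀ i j, i ≠ j → ∀ t : Fin 5, (∀ s, Equiv.subLeft t s ∈ Q j ↔ s ∈ Q j) → ∃ s, ¬ (Equiv.subLeft t s ∈ Q i ↔ s ∈ Q i))
    (c : ι → Fin 5 → ℚ) (hc : ∀ i s, c i s = 5 * (if s ∈ Q i then 1 else 0) - (Q i).card)
    (x y : ι → ℚ) (hrel : ∀ s : Fin 5, ∑ i, (x i * c i s + y i * (c i (s + 1) + c i (s - 1) - c i (s + 2) - c i (s - 2))) = 0) (i : ι) :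
    x i = 0 ∧ y i = 0 := by
  have hprop : ∀ i, (Q i).Nonempty ∧ Q i ≠ Finset.univ := fun i =>
    ⟨Finset.card_pos.1 (by rw [hQ i]; norm_num), fun h => by have := hQ i; rw [h, Finset.card_univ, Fintype.card_fin] at this; omega⟩
  refine fIndependent_of_card_le_two hι c (fun i => (centred_five_sum_eq_zero_and_ne (Q i) (c i) (hc i) (hprop i).1 (hprop i).2).1)
    (fun i => (centred_five_sum_eq_zero_and_ne (Q i) (c i) (hc i) (hprop i).1 (hprop i).2).2) (fun i j hij => ?_) x y hrel i
  obtain ⟨t, ht, -⟩ := exists_subLeft_stabilising_pair (hQ j)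
  obtain ⟨s, hs⟩ := hsum i j hij t ht
  exact ⟨Equiv.subLeft t, Or.inr (subLeft_add_eq t), fun s => (centred_five_comp_eq_iff (Q j) (c j) (hc j) _ s).2 (ht s),
    s, fun h => hs ((centred_five_comp_eq_iff (Q i) (c i) (hc i) _ s).1 h)⟩

end Criterion

/-! ## §4 Transport under conjugation; the conjugated dihedral pentagon -/

section Conj

/-- **Separation is invariant under conjugation** (any size `k`): if every solution of the signed equations of `(g⁻¹ H g, g⁻¹ Q)` is constant, so is every solution for
`(H, Q)` — substitute `a ↦ g a`. [folklore] -/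
theorem const_of_signed_of_conj {k : ℕ} {ι : Type} [Fintype ι] (g : Equiv.Perm (Fin k)) (H : Finset (Equiv.Perm (Fin k))) (Q : ι → Finset (Fin k))
    (hsep : ∀ (u' : ι → Fin k → ℤ) (w' : ℤ), (∀ σ ∈ H, (∑ i, ∑ a, if (g⁻¹ * σ * g) a ∈ (Q i).image ⇑g⁻¹ then u' i a else -u' i a) = w') →
      ∀ (i : ι) (a b : Fin k), u' i a = u' i b)
    (u : ι → Fin k → ℤ) {w : ℤ} (h : ∀ σ ∈ H, (∑ i, ∑ a, if σ a ∈ Q i then u i a else -u i a) = w) (i : ι) (a b : Fin k) : u i a = u i b := by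
  have hmem : ∀ (σ : Equiv.Perm (Fin k)) (i : ι) (a : Fin k), (g⁻¹ * σ * g) a ∈ (Q i).image ⇑g⁻¹ ↔ σ (g a) ∈ Q i := fun σ i a => by
    rw [Equiv.Perm.mul_apply, Equiv.Perm.mul_apply]
    constructor
    · intro hm
      obtain ⟨x, hx, hxe⟩ := Finset.mem_image.1 hm
      rwa [g⁻¹.injective hxe] at hx
    · intro hm
      exact Finset.mem_image.2 ⟨_, hm, rfl⟩
  have key := hsep (fun i a => u i (g a)) w fun σ hσ => by
    rw [← h σ hσ]
    refine Finset.sum_congr rfl fun i _ => ?_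
    rw [← Equiv.sum_comp g (fun a => if σ a ∈ Q i then u i a else -u i a)]
    refine Finset.sum_congr rfl fun a _ => ?_
    simp only [hmem]
  have := key i (g⁻¹ a) (g⁻¹ b)
  simpa using this

variable {H : Finset (Equiv.Perm (Fin 5))}

/-- **SEPARATION OVER A CONJUGATED DIHEDRAL PENTAGON.**  As `const_of_signed_dihedral_five`, with the ten dihedral maps conjugated by an arbitrary `g ∈ Sym(5)` (the form in
which the realised tuples present a dihedral image once an element of order `5` has been conjugated to the standard rotation) and the `ℚ[A]`-independence asked of the
transported sets `g⁻¹ Q_i` (centred indicators `s ↦ 5·[g s ∈ Q_i] − |Q_i|`). [cite: Serre1977, §2.3 Ex. 2.6; §5.3] [cite: Washington1997, Lemma 2.4] [cite: Lang2002, XIII §4] -/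
theorem const_of_signed_dihedral_five_conj {ι : Type} [Fintype ι] (g : Equiv.Perm (Fin 5))
    (hrot : ∀ t : Fin 5, g * Equiv.addRight t * g⁻¹ ∈ H) (hrefl : ∀ t : Fin 5, g * Equiv.subLeft t * g⁻¹ ∈ H)
    (Q : ι → Finset (Fin 5)) (u : ι → Fin 5 → ℤ) {w : ℤ}
    (h : ∀ σ ∈ H, (∑ i, ∑ a : Fin 5, (if σ a ∈ Q i then u i a else -u i a)) = w)
    (c : ι → Fin 5 → ℚ) (hc : ∀ i s, c i s = 5 * (if g s ∈ Q i then 1 else 0) - (Q i).card)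
    (hF : ∀ x y : ι → ℚ, (∀ s : Fin 5, ∑ i, (x i * c i s + y i * (c i (s + 1) + c i (s - 1) - c i (s + 2) - c i (s - 2))) = 0) →
      ∀ i, x i = 0 ∧ y i = 0)
    (i : ι) (a b : Fin 5) : u i a = u i b := by
  refine const_of_signed_of_conj g H Q (fun u' w' h' => ?_) u h i a b
  have hmem : ∀ (i : ι) (s : Fin 5), s ∈ (Q i).image ⇑g⁻¹ ↔ g s ∈ Q i := fun i s => by
    constructor
    · intro hm
      obtain ⟨x, hx, hxe⟩ := Finset.mem_image.1 hm
      rw [← hxe]; simpa using hx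
    · intro hm
      exact Finset.mem_image.2 ⟨_, hm, by simp⟩
  have hconj : ∀ ρ : Equiv.Perm (Fin 5), g * ρ * g⁻¹ ∈ H → ρ ∈ H.image fun σ => g⁻¹ * σ * g := fun ρ hρ =>
    Finset.mem_image.2 ⟨_, hρ, by group⟩
  refine const_of_signed_dihedral_five (H := H.image fun σ => g⁻¹ * σ * g) (fun t => hconj _ (hrot t)) (fun t => hconj _ (hrefl t))
    (fun i => (Q i).image ⇑g⁻¹) u' (w := w') (fun σ' hσ' => ?_) c (fun i s => ?_) hF
  · obtain ⟨σ, hσ, rfl⟩ := Finset.mem_image.1 hσ'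
    exact h' σ hσ
  · rw [hc, Finset.card_image_of_injective _ g⁻¹.injective]
    simp only [hmem]

end Conj

end Summit.HodgeConjecture.CorCM.MultiFieldWeil

end
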